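import Summits.ResolutionOfSingularities.ResolutionOfSingularities.Theorems.FrobeniusLadderFRationalResolutionOneSopStalk
import Summits.ResolutionOfSingularities.ResolutionOfSingularities.Theorems.FrobeniusLadderFRationalResolutionStalkPresentationRegular
import HarnessLib

/-!
# Hochster–Huneke 1994, Prop. 6.27 (a), at the stalks of `k`-schemes locally of finite type

Support file for crux stmt-ResolutionOfSingularities-15317 (`FrobeniusLadder.FRationalResolution`),
line `Sketch`, continuation seat c3, cycle 5. For `f : X → Spec k` locally of finite type over a
field `k` of characteristic `p` and a point `x` with integral stalk `𝒪_{X,x}`: if ONE ideal of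
`𝒪_{X,x}` generated by `dim 𝒪_{X,x}` elements with maximal radical is tightly closed (inline form),
then the whole F-rational clause of the crux holds at `x`. Assembly of the presentation
`𝒪_{X,x} ≃+* S ⧸ Q` with `S` regular local of characteristic `p` and `Q` prime
(`exists_stalk_ringEquiv_regularLocal_quotient`, p153612) with the transported one-ideal criterion
(`fRationalClause_of_one_of_ringEquiv_quotient`, p153611, over `prop627a_quotient` p151811).
Use: certifying a candidate model (rung 3 / piece X₁ outputs) as F-rational is ONE tight-closure
membership test per point. [cite: HochsterHuneke1994, Prop. 6.27 (a)]
-/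

-- single-problem summit: the doubled namespace component is forced
set_option linter.dupNamespace false

noncomputable section

namespace Summit.ResolutionOfSingularities.ResolutionOfSingularities.Theorems.FRationalResolution

open CategoryTheory AlgebraicGeometry TopologicalSpace

/-- **One tightly closed parameter ideal per point suffices (HH94 Prop. 6.27 (a) at a stalk).**
Let `f : X → Spec k` be locally of finite type, `char k = p`, and `x ∈ X` a point whose stalk is a
domain. If one ideal of `𝒪_{X,x}` generated by `d₀ = dim 𝒪_{X,x}` elements with maximal radical is
tightly closed (`c ≠ 0 ∧ (∀ e, c·y^(p^e) ∈ (s₀)^[p^e]) ⇒ y ∈ (s₀)`), then EVERY ideal of `𝒪_{X,x}`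
generated by a full system of parameters is tightly closed — the F-rational clause of crux
`FRationalResolution` at `x`. [cite: HochsterHuneke1994, Prop. 6.27 (a)] -/
theorem fRationalClause_of_one_sop_stalk (p : ℕ) (hp : p.Prime) (k : Type) [Field k] [CharP k p]
    (X : Scheme.{0}) (f : X ⟶ Spec (.of k)) [LocallyOfFiniteType f] (x : X)
    [IsDomain (X.presheaf.stalk x)] {d₀ : ℕ} (hd₀ : ringKrullDim (X.presheaf.stalk x) = d₀)
    (s₀ : Fin d₀ → X.presheaf.stalk x) (hs₀ : (Ideal.span (Set.range s₀)).radical.IsMaximal)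
    (htc₀ : ∀ y c : X.presheaf.stalk x, c ≠ 0 → (∀ e : ℕ, c * y ^ p ^ e ∈
      Ideal.span ((fun z : X.presheaf.stalk x => z ^ p ^ e) ''
        (Ideal.span (Set.range s₀) : Set (X.presheaf.stalk x)))) → y ∈ Ideal.span (Set.range s₀)) :
    IsDomain (X.presheaf.stalk x) ∧ ∀ d : ℕ, ringKrullDim (X.presheaf.stalk x) = d →
      ∀ s : Fin d → X.presheaf.stalk x, (Ideal.span (Set.range s)).radical.IsMaximal →
      ∀ y c : X.presheaf.stalk x, c ≠ 0 →
      (∀ e : ℕ, c * y ^ p ^ e ∈ Ideal.span ((fun z : X.presheaf.stalk x => z ^ p ^ e) ''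
        (Ideal.span (Set.range s) : Set (X.presheaf.stalk x)))) → y ∈ Ideal.span (Set.range s) := by
  haveI : Fact p.Prime := ⟨hp⟩
  obtain ⟨S, _, _, _, Q, hQ, ⟨e⟩⟩ := exists_stalk_ringEquiv_regularLocal_quotient hp k X f x
  haveI := hQ
  haveI : Nontrivial (S ⧸ Q) := Ideal.Quotient.nontrivial_iff.mpr hQ.ne_top
  haveI : IsLocalRing (S ⧸ Q) :=
    IsLocalRing.of_surjective' (Ideal.Quotient.mk Q) Ideal.Quotient.mk_surjective
  exact fRationalClause_of_one_of_ringEquiv_quotient p Q e hd₀ s₀ hs₀ htc₀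

/-- **Scheme form.** For `f : X → Spec k` locally of finite type (`char k = p`) with integral
stalks, a choice at every point `x` of ONE tightly closed ideal generated by `dim 𝒪_{X,x}` elements
with maximal radical yields the F-rational hypothesis of crux `FRationalResolution` at every point
of `X`. [cite: HochsterHuneke1994, Prop. 6.27 (a)] -/
theorem fRationalClause_of_one_sop (p : ℕ) (hp : p.Prime) (k : Type) [Field k] [CharP k p]
    (X : Scheme.{0}) (f : X ⟶ Spec (.of k)) [LocallyOfFiniteType f]
    (h : ∀ x : X, IsDomain (X.presheaf.stalk x) ∧ ∃ (d₀ : ℕ) (s₀ : Fin d₀ → X.presheaf.stalk x),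
      ringKrullDim (X.presheaf.stalk x) = d₀ ∧ (Ideal.span (Set.range s₀)).radical.IsMaximal ∧
      ∀ y c : X.presheaf.stalk x, c ≠ 0 → (∀ e : ℕ, c * y ^ p ^ e ∈
        Ideal.span ((fun z : X.presheaf.stalk x => z ^ p ^ e) ''
          (Ideal.span (Set.range s₀) : Set (X.presheaf.stalk x)))) →
        y ∈ Ideal.span (Set.range s₀)) :
    ∀ x : X, IsDomain (X.presheaf.stalk x) ∧ ∀ d : ℕ, ringKrullDim (X.presheaf.stalk x) = d →
      ∀ s : Fin d → X.presheaf.stalk x, (Ideal.span (Set.range s)).radical.IsMaximal →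
      ∀ y c : X.presheaf.stalk x, c ≠ 0 →
      (∀ e : ℕ, c * y ^ p ^ e ∈ Ideal.span ((fun z : X.presheaf.stalk x => z ^ p ^ e) ''
        (Ideal.span (Set.range s) : Set (X.presheaf.stalk x)))) → y ∈ Ideal.span (Set.range s) := by
  intro x
  obtain ⟨hdom, d₀, s₀, hd₀, hs₀, htc₀⟩ := h x
  haveI := hdom
  exact fRationalClause_of_one_sop_stalk p hp k X f x hd₀ s₀ hs₀ htc₀

end Summit.ResolutionOfSingularities.ResolutionOfSingularities.Theorems.FRationalResolution

end
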